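import Mathlib
import Literature.NumberTheory.LFunctions.Zhang2022.Section15CalM1Ratio
import Literature.NumberTheory.LFunctions.Zhang2022.Section15EulerMajorant
import Literature.NumberTheory.LFunctions.Zhang2022.Section15BStep15u035
import Literature.NumberTheory.LFunctions.Zhang2022.Section3Lemma31
import HarnessLib

/-!
# Zhang (2022) §15 p.87, the leaf `Z22:§15.u050` DISCHARGED:
# `Σ_{n∉𝒩(𝒬), n<T} χ(n)τ₂(n)ϖ₁ⱼ(n)/n ≪ 1/𝓛`

Topic `Literature/NumberTheory/LFunctions/Zhang2022` (Landau–Siegel audit tree; verdict-neutral).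
Y. Zhang, *Discrete mean estimates and the Landau–Siegel zero*, arXiv:2211.02515v1 (2022)
[Zhang2022LandauSiegel] — **an unrefereed manuscript under adjudication; nothing here asserts or denies
its Theorems 1–2.** ZHANG-L discharge lane (WP15): the v19 frontier hypothesis
`h15u050 : Typed.Section15C.Step15_u050 c′ Typed.Section15C.inputs15AB` of
`Skeleton.theorem1_of_leaves_v19` is proved for every `c′` (`step15_u050_holds`), from tree theorems only:
the multiplicativity of `ϖ₁ⱼ` and (15.21) (`Section15CalM1Ratio`: `inline15_varpiMult_holds`,
`eq15_21_holds`), §15.u035 (`step15_u035_holds`), Lemma 15.2 (`norm_calM1_one_one_betaJ_ge`), Lemma 3.1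
(`Lemma31.lemma_3_1`), the Euler-product majorants and Mertens bounds of `Section15EulerMajorant`.

## The argument (the manuscript's "This yields, by (15.21), … ≪ 1/𝓛", p.87 tex L4314, unfolded)

Write every `n < T`, `n ∉ 𝒩(𝒬)` uniquely as `n = n₁n₂` with `n₁ ∈ 𝒩(𝒬)` and `(n₂,𝒬) = 1`, `n₂ > 1`
(so every prime factor of `n₂` is `≥ D⁴`). By the multiplicativity of `τ₂` and `ϖ₁ⱼ`,
`|Σ| ≤ S₁·S₂` with `S₁ = Σ_{n₁∈𝒩(𝒬), n₁<T} τ₂(n₁)|ϖ₁ⱼ(n₁)|/n₁` and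
`S₂ = Σ_{1<n₂<T, (n₂,𝒬)=1} τ₂(n₂)|ϖ₁ⱼ(n₂)|/n₂` (`norm_sumNotInN_le_mul`).
* `S₁ ≪ 𝓛⁴` (`smooth_part_le`): `|ϖ₁ⱼ(n)| ≤ 2|C|τ₂(n)∏_{q∣n}(1+8/q)(1+|c|q^{−9/10})` from
  `|𝓜₁(d,l;1−βⱼ)| ≤ C∏_{q∣dl}(1+cq^{−9/10})` (§15.u035), `|𝓜₁(1,1;1−βⱼ)| ≥ 1/2` (Lemma 15.2) and
  `|λ₁(q)| ≤ 1 + 8/q`; then the Euler-product majorant over the `D⁴`-smooth numbers and Mertens.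
* `S₂ ≪ 𝓛⁻⁶` (`rough_part_le`): by (15.21), `|ϖ₁ⱼ(n₂)| ≤ |ϱ*ⱼ(n₂)| + Cτ₂(n₂)D⁻ᶜ`, and
  `|ϱ*ⱼ(n₂)| ≤ τ₂(n₂)|bⱼ|log T + |ν(n₂)|` (`|q^{βⱼ} − 1| ≤ |bⱼ|log q`); the `ν`-part is handled by
  Cauchy–Schwarz and Lemma 3.1 (`Σ_{D⁴<n≤T}|ν(n)|²/n ≪ 𝓛⁻²⁰¹¹`), the rest by the majorant of
  `Σ_{(n,𝒬)=1, n<T} τ₂(n)²/n ≪ 𝓛` (two-sided Mertens: the primes in `[D⁴,T)` have `Σ1/q ≤ 0.1 log 𝓛 + O(1)`)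
  and `|bⱼ|log T ≪ α𝓛^{1.1} ≤ π𝓛⁻⁷`.

## References

* Y. Zhang, arXiv:2211.02515v1 (2022), §15 p.87 (tex L4310–L4315), (15.21) p.86, Lemma 3.1 p.6.
  [cite: Zhang2022LandauSiegel, §15 p.87]
-/

noncomputable section

open Complex Real Filter Finset
open _root_.Topology
open Literature.NumberTheory.LFunctions.Zhang2022.Skeleton
open Literature.NumberTheory.LFunctions.Zhang2022.Typed.Section15A (lam1)
open Literature.NumberTheory.LFunctions.Zhang2022.Typed.Section15B (varpi1 calM1)

namespace Literature.NumberTheory.LFunctions.Zhang2022.Typed.Section15C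

/-! ## §1. The smooth × rough split -/

section Split

variable (c' : ℝ) {D : ℕ} [NeZero D] (χ : DirichletCharacter ℂ D) (j : ℕ)

/-- `τ₂(mn) = τ₂(m)τ₂(n)` for `(m,n) = 1` (`σ₀` is multiplicative). [folklore] -/
private theorem card_divisors_mul {m n : ℕ} (hmn : Nat.Coprime m n) :
    ((m * n).divisors.card : ℝ) = (m.divisors.card : ℝ) * (n.divisors.card : ℝ) := by
  have h := (ArithmeticFunction.isMultiplicative_sigma (k := 0)).map_mul_of_coprime hmn
  simp only [ArithmeticFunction.sigma_zero_apply] at h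
  exact_mod_cast h

/-- A number `> 1` coprime to `𝒬` is not in `𝒩(𝒬)`, and `𝒩(𝒬)·(such a number)` stays outside `𝒩(𝒬)`:
if `n₁n₂ ∈ 𝒩(𝒬)` with `(n₂,𝒬) = 1` then `n₂ = 1`. [cite: Zhang2022LandauSiegel, §15 p.86] -/
private theorem eq_one_of_mul_mem_nset {K n₁ n₂ : ℕ} (h : n₁ * n₂ ∈ nset K)
    (h₂ : Nat.Coprime n₂ K) : n₂ = 1 := by
  by_contra hne
  have hn₂0 : n₂ ≠ 0 := fun h0 => by
    rw [h0, mul_zero] at h; exact (lt_irrefl 0) h.1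
  obtain ⟨p, hp, hpn⟩ := Nat.exists_prime_and_dvd hne
  have hpK : p ∣ K := h.2 p hp (dvd_mul_of_dvd_right hpn n₁)
  have h1 : p ∣ Nat.gcd n₂ K := Nat.dvd_gcd hpn hpK
  rw [Nat.Coprime.gcd_eq_one h₂] at h1
  exact hp.one_lt.ne' (Nat.dvd_one.mp h1)

open scoped Classical in
/-- **The smooth × rough split** (§15 p.86–87: "every `n` can be uniquely written as `n = n₁n₂` with
`n₁ ∈ 𝒩(𝒬)` and `(n₂,𝒬) = 1`", here for `n ∉ 𝒩(𝒬)`, i.e. `n₂ > 1`): if `ϖ = ϖ₁ⱼ` is multiplicative,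
then `‖Σ_{n∉𝒩(𝒬),n<T} χ(n)τ₂(n)ϖ(n)/n‖ ≤ (Σ_{n₁∈𝒩(𝒬),n₁<T} τ₂(n₁)‖ϖ(n₁)‖/n₁)·
(Σ_{1<n₂<T,(n₂,𝒬)=1} τ₂(n₂)‖ϖ(n₂)‖/n₂)`. [cite: Zhang2022LandauSiegel, §15 p.87] -/
theorem norm_sumNotInN_le_mul
    (hmul : ∀ m n : ℕ, Nat.Coprime m n → varpi1 c' χ j (m * n) = varpi1 c' χ j m * varpi1 c' χ j n) :
    ‖sumNotInN c' inputs15AB χ j‖ ≤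
      (∑ n ∈ (Finset.Ico 1 ⌈bigT D⌉₊).filter (fun n => n ∈ nset (frakq D)),
          (n.divisors.card : ℝ) * ‖varpi1 c' χ j n‖ / n) *
        ∑ n ∈ (Finset.Ico 2 ⌈bigT D⌉₊).filter (fun n => Nat.Coprime n (frakq D)),
          (n.divisors.card : ℝ) * ‖varpi1 c' χ j n‖ / n := by
  set N := ⌈bigT D⌉₊ with hN
  set K := frakq D with hK
  set g : ℕ → ℝ := fun n => (n.divisors.card : ℝ) * ‖varpi1 c' χ j n‖ / n with hg
  have hg0 : ∀ n, 0 ≤ g n := fun n => by rw [hg]; positivity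
  set S := (Finset.Ico 1 N).filter (fun n => n ∈ nset K) with hS
  set R := (Finset.Ico 2 N).filter (fun n => Nat.Coprime n K) with hR
  set E := (Finset.Ico 1 N).filter (fun n => n ∉ nset K) with hE
  -- termwise bound of the sum by `Σ_E g`
  have h1 : ‖sumNotInN c' inputs15AB χ j‖ ≤ ∑ n ∈ E, g n := by
    rw [sumNotInN]
    refine (norm_sum_le _ _).trans (Finset.sum_le_sum fun n hn => ?_)
    rw [inputs15AB_varpi1, hg]
    simp only
    rw [norm_div, norm_mul, norm_mul, Complex.norm_natCast, Complex.norm_natCast]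
    have hχ : ‖χ (n : ZMod D)‖ ≤ 1 := χ.norm_le_one _
    have h0 : 0 ≤ (n.divisors.card : ℝ) * ‖varpi1 c' χ j n‖ := by positivity
    apply div_le_div_of_nonneg_right _ (Nat.cast_nonneg n)
    nlinarith
  refine h1.trans ?_
  -- `Σ_E g = Σ_{(n₁,n₂)∈S×R, n₁n₂<N} g(n₁)g(n₂) ≤ Σ_{S×R} g(n₁)g(n₂)`
  have h2 : ∑ x ∈ (S ×ˢ R).filter (fun x => x.1 * x.2 < N), g x.1 * g x.2 = ∑ n ∈ E, g n := by
    refine Finset.sum_bij (fun x _ => x.1 * x.2) ?_ ?_ ?_ ?_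
    · intro x hx
      simp only [Finset.mem_filter, Finset.mem_product, hS, hR, Finset.mem_Ico] at hx
      obtain ⟨⟨⟨⟨hx1a, -⟩, hx1n⟩, ⟨⟨hx2a, -⟩, hx2c⟩⟩, hxN⟩ := hx
      rw [hE, Finset.mem_filter, Finset.mem_Ico]
      refine ⟨⟨Nat.one_le_iff_ne_zero.mpr (Nat.mul_ne_zero (by omega) (by omega)), hxN⟩, ?_⟩
      intro hmem
      have := eq_one_of_mul_mem_nset hmem hx2c
      omega
    · intro x hx y hy hxy
      simp only [Finset.mem_filter, Finset.mem_product, hS, hR, Finset.mem_Ico] at hx hy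
      obtain ⟨h1, h2⟩ := Section15B.smooth_mul_rough_unique hxy hx.1.1.2 hx.1.2.2 hy.1.1.2 hy.1.2.2
      exact Prod.ext h1 h2
    · intro m hm
      rw [hE, Finset.mem_filter, Finset.mem_Ico] at hm
      obtain ⟨n₁, n₂, hprod, hn₁, hn₂⟩ := Section15B.exists_smooth_mul_rough D (m := m) (by omega)
      have hn₁0 : n₁ ≠ 0 := fun h0 => by rw [h0, zero_mul] at hprod; omega
      have hn₂0 : n₂ ≠ 0 := fun h0 => by rw [h0, mul_zero] at hprod; omega
      have hn₂1 : n₂ ≠ 1 := fun h1 => by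
        rw [h1, mul_one] at hprod
        exact hm.2 (hprod ▸ hn₁)
      have hn₁m : n₁ ≤ m := by
        rw [← hprod]; exact Nat.le_mul_of_pos_right _ (Nat.pos_of_ne_zero hn₂0)
      have hn₂m : n₂ ≤ m := by
        rw [← hprod]; exact Nat.le_mul_of_pos_left _ (Nat.pos_of_ne_zero hn₁0)
      refine ⟨(n₁, n₂), ?_, hprod⟩
      simp only [Finset.mem_filter, Finset.mem_product, hS, hR, Finset.mem_Ico]
      exact ⟨⟨⟨⟨by omega, by omega⟩, hn₁⟩, ⟨by omega, by omega⟩, hn₂⟩, by omega⟩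
    · intro x hx
      simp only [Finset.mem_filter, Finset.mem_product, hS, hR, Finset.mem_Ico] at hx
      have hcop : Nat.Coprime x.1 x.2 :=
        Section15B.coprime_of_mem_nset_of_coprime hx.1.1.2 hx.1.2.2
      have hx1 : (x.1 : ℝ) ≠ 0 := by exact_mod_cast (show x.1 ≠ 0 by omega)
      have hx2 : (x.2 : ℝ) ≠ 0 := by exact_mod_cast (show x.2 ≠ 0 by omega)
      rw [hg]
      simp only
      rw [hmul x.1 x.2 hcop, norm_mul, card_divisors_mul hcop]
      push_cast
      field_simp
  rw [← h2, Finset.sum_mul_sum, ← Finset.sum_product' (f := fun a b => g a * g b)]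
  refine Finset.sum_le_sum_of_subset_of_nonneg (Finset.filter_subset _ _) fun x _ _ => ?_
  exact mul_nonneg (hg0 _) (hg0 _)

end Split

/-! ## §2. The smooth part `S₁ ≪ 𝓛⁴` -/

section Smooth

variable (c' : ℝ) {D : ℕ} [NeZero D] (χ : DirichletCharacter ℂ D) (j : ℕ)

/-- `∏_{i∈s} f ≤ ∏_{i∈t} f` for `s ⊆ t` and `f ≥ 1` on `t` (real version). [folklore] -/
private theorem prod_le_prod_of_subset_real {s t : Finset ℕ} (h : s ⊆ t) {f : ℕ → ℝ}
    (hf : ∀ i ∈ t, 1 ≤ f i) : ∏ i ∈ s, f i ≤ ∏ i ∈ t, f i := by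
  classical
  rw [← Finset.prod_sdiff h]
  have h1 : 1 ≤ ∏ i ∈ t \ s, f i :=
    Finset.prod_induction _ (fun x : ℝ => 1 ≤ x)
      (fun a b ha hb => one_le_mul_of_one_le_of_one_le ha hb) le_rfl
      (fun i hi => hf i (Finset.sdiff_subset hi))
  have h2 : 0 ≤ ∏ i ∈ s, f i := Finset.prod_nonneg fun i hi => zero_le_one.trans (hf i (h hi))
  nlinarith

omit [NeZero D] in
/-- `‖λ₁(d)‖ ≤ ∏_{q∣n}(1 + 8/q)` for `d ∣ n ≠ 0` (`λ₁(d) = ∏_{q∣d}λ₁(q)`, `|λ₁(q)| ≤ 1 + 8/q` by the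
tree's `norm_lam1_prime_one_sub_one_le`). [cite: Zhang2022LandauSiegel, §15 (15.10) p.82] -/
theorem norm_lam1_le_prod_primeFactors {d n : ℕ} (hn : n ≠ 0) (hd : d ∣ n) :
    ‖lam1 c' χ d 1‖ ≤ ∏ q ∈ n.primeFactors, (1 + 8 / (q : ℝ)) := by
  rw [Section15B.lam1_eq_prod_primeFactors, norm_prod]
  calc ∏ q ∈ d.primeFactors, ‖lam1 c' χ q 1‖ ≤ ∏ q ∈ d.primeFactors, (1 + 8 / (q : ℝ)) := by
        refine Finset.prod_le_prod (fun q _ => norm_nonneg _) fun q hq => ?_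
        have h := Section15B.norm_lam1_prime_one_sub_one_le c' χ (Nat.prime_of_mem_primeFactors hq)
        have h2 := norm_add_le (lam1 c' χ q 1 - 1) 1
        rw [sub_add_cancel, norm_one] at h2
        linarith
    _ ≤ ∏ q ∈ n.primeFactors, (1 + 8 / (q : ℝ)) :=
        prod_le_prod_of_subset_real (Nat.primeFactors_mono hd hn) fun q _ => by
          have : (0 : ℝ) ≤ 8 / q := by positivity
          linarith

/-- `#{(d,l) : dl = n} = τ₂(n)`. [folklore] -/
private theorem card_divisorsAntidiagonal_eq (n : ℕ) : n.divisorsAntidiagonal.card = n.divisors.card := by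
  rw [← Nat.map_div_right_divisors, Finset.card_map]

omit [NeZero D] in
/-- **Pointwise bound for `ϖ₁ⱼ` on all `n ≥ 1`** from §15.u035 and Lemma 15.2: if
`‖𝓜₁(d,l;1−βⱼ)‖ ≤ C∏_{q∣dl}(1 + cq^{−9/10})` for all `d,l ≥ 1` and `‖𝓜₁(1,1;1−βⱼ)‖ ≥ 1/2`, then
`‖ϖ₁ⱼ(n)‖ ≤ 2|C|·τ₂(n)·∏_{q∣n}(1 + 8/q)(1 + |c|q^{−9/10})` (each of the `τ₂(n)` summands
`λ₁(d)d^{βⱼ}χ(l)𝓜₁(d,l)/𝓜₁(1,1)` of `ϖ₁ⱼ(n)` is bounded by `‖λ₁(d)‖·‖𝓜₁(d,l)‖·2`).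
[cite: Zhang2022LandauSiegel, §15 p.85] -/
theorem norm_varpi1_le_of_bounds {c₀ C₀ : ℝ}
    (h35 : ∀ d l : ℕ, 1 ≤ d → 1 ≤ l → ‖calM1 c' χ d l (1 - betaJ c' D j)‖ ≤
      C₀ * ∏ q ∈ (d * l).primeFactors, (1 + c₀ * (q : ℝ) ^ (-(9 / 10 : ℝ))))
    (hM : 1 / 2 ≤ ‖calM1 c' χ 1 1 (1 - betaJ c' D j)‖) {n : ℕ} (hn : n ≠ 0) :
    ‖varpi1 c' χ j n‖ ≤ 2 * |C₀| * (n.divisors.card : ℝ) *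
      ∏ q ∈ n.primeFactors, ((1 + 8 / (q : ℝ)) * (1 + |c₀| * (q : ℝ) ^ (-(9 / 10 : ℝ)))) := by
  set s : ℂ := 1 - betaJ c' D j with hs
  set P₁ : ℝ := ∏ q ∈ n.primeFactors, (1 + 8 / (q : ℝ)) with hP₁
  set P₂ : ℝ := ∏ q ∈ n.primeFactors, (1 + |c₀| * (q : ℝ) ^ (-(9 / 10 : ℝ))) with hP₂
  have hP₁0 : 0 ≤ P₁ := Finset.prod_nonneg fun q _ => by positivity
  have hP₂0 : 0 ≤ P₂ := Finset.prod_nonneg fun q _ => by positivity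
  have hM0 : calM1 c' χ 1 1 s ≠ 0 := by
    intro h0; rw [hs] at hM; rw [h0, norm_zero] at hM; linarith
  -- each summand is bounded by `2|C₀|·P₁·P₂`
  have hterm : ∀ x ∈ n.divisorsAntidiagonal,
      ‖lam1 c' χ x.1 1 * (x.1 : ℂ) ^ betaJ c' D j * χ (x.2 : ZMod D) *
          (calM1 c' χ x.1 x.2 s / calM1 c' χ 1 1 s)‖ ≤ 2 * |C₀| * (P₁ * P₂) := by
    intro x hx
    have hx' := Nat.mem_divisorsAntidiagonal.mp hx
    have hx1 : 1 ≤ x.1 := Nat.pos_of_ne_zero fun h0 => hx'.2 (by rw [← hx'.1, h0, zero_mul])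
    have hx2 : 1 ≤ x.2 := Nat.pos_of_ne_zero fun h0 => hx'.2 (by rw [← hx'.1, h0, mul_zero])
    have hdvd : x.1 ∣ n := ⟨x.2, hx'.1.symm⟩
    have hlam : ‖lam1 c' χ x.1 1‖ ≤ P₁ := norm_lam1_le_prod_primeFactors c' χ hn hdvd
    have hβ : ‖(x.1 : ℂ) ^ betaJ c' D j‖ = 1 := Section15B.norm_natCast_cpow_betaJ c' D j hx1
    have hχ : ‖χ (x.2 : ZMod D)‖ ≤ 1 := χ.norm_le_one _
    have hM₁ : ‖calM1 c' χ x.1 x.2 s‖ ≤ |C₀| * P₂ := by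
      have h := h35 x.1 x.2 hx1 hx2
      rw [hx'.1] at h
      refine h.trans ?_
      calc C₀ * ∏ q ∈ n.primeFactors, (1 + c₀ * (q : ℝ) ^ (-(9 / 10 : ℝ)))
          ≤ |C₀ * ∏ q ∈ n.primeFactors, (1 + c₀ * (q : ℝ) ^ (-(9 / 10 : ℝ)))| := le_abs_self _
        _ = |C₀| * ∏ q ∈ n.primeFactors, |1 + c₀ * (q : ℝ) ^ (-(9 / 10 : ℝ))| := by
            rw [abs_mul, Finset.abs_prod]
        _ ≤ |C₀| * P₂ := by
            refine mul_le_mul_of_nonneg_left ?_ (abs_nonneg _)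
            refine Finset.prod_le_prod (fun q _ => abs_nonneg _) fun q _ => ?_
            have hr : 0 ≤ (q : ℝ) ^ (-(9 / 10 : ℝ)) := Real.rpow_nonneg (Nat.cast_nonneg q) _
            calc |1 + c₀ * (q : ℝ) ^ (-(9 / 10 : ℝ))| ≤ |(1 : ℝ)| + |c₀ * (q : ℝ) ^ (-(9 / 10 : ℝ))| :=
                  abs_add_le _ _
              _ = 1 + |c₀| * (q : ℝ) ^ (-(9 / 10 : ℝ)) := by rw [abs_one, abs_mul, abs_of_nonneg hr]
    have hquot : ‖calM1 c' χ x.1 x.2 s / calM1 c' χ 1 1 s‖ ≤ 2 * (|C₀| * P₂) := by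
      rw [norm_div, div_le_iff₀ (by linarith)]
      nlinarith [norm_nonneg (calM1 c' χ x.1 x.2 s), abs_nonneg C₀]
    calc ‖lam1 c' χ x.1 1 * (x.1 : ℂ) ^ betaJ c' D j * χ (x.2 : ZMod D) *
            (calM1 c' χ x.1 x.2 s / calM1 c' χ 1 1 s)‖
        = ‖lam1 c' χ x.1 1‖ * ‖(x.1 : ℂ) ^ betaJ c' D j‖ * ‖χ (x.2 : ZMod D)‖ *
            ‖calM1 c' χ x.1 x.2 s / calM1 c' χ 1 1 s‖ := by
          rw [norm_mul, norm_mul, norm_mul]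
      _ ≤ P₁ * 1 * 1 * (2 * (|C₀| * P₂)) := by
          rw [hβ]
          gcongr
      _ = 2 * |C₀| * (P₁ * P₂) := by ring
  calc ‖varpi1 c' χ j n‖
      ≤ ∑ x ∈ n.divisorsAntidiagonal, ‖lam1 c' χ x.1 1 * (x.1 : ℂ) ^ betaJ c' D j *
          χ (x.2 : ZMod D) * (calM1 c' χ x.1 x.2 s / calM1 c' χ 1 1 s)‖ := by
        rw [Section15B.varpi1]; exact norm_sum_le _ _
    _ ≤ ∑ x ∈ n.divisorsAntidiagonal, 2 * |C₀| * (P₁ * P₂) := Finset.sum_le_sum hterm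
    _ = (n.divisors.card : ℝ) * (2 * |C₀| * (P₁ * P₂)) := by
        rw [Finset.sum_const, nsmul_eq_mul, card_divisorsAntidiagonal_eq]
    _ = 2 * |C₀| * (n.divisors.card : ℝ) *
          ∏ q ∈ n.primeFactors, ((1 + 8 / (q : ℝ)) * (1 + |c₀| * (q : ℝ) ^ (-(9 / 10 : ℝ)))) := by
        rw [hP₁, hP₂, ← Finset.prod_mul_distrib]; ring

/-- The weight arithmetic of the smooth part: for `0 ≤ u ≤ 1/2`, `0 ≤ v ≤ 1`, `u ≤ v`, `c ≥ 0`,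
`(1+8u)(1+cv)(4u+180u²) ≤ 4u + (1652+920c)uv` (used with `u = 1/p`, `v = p^{−9/10}`). [folklore] -/
private theorem weight_term_le {u v c : ℝ} (hu0 : 0 ≤ u) (hu : u ≤ 1 / 2) (hv0 : 0 ≤ v) (hv1 : v ≤ 1)
    (huv : u ≤ v) (hc : 0 ≤ c) :
    (1 + 8 * u) * (1 + c * v) * (4 * u + 180 * u ^ 2) ≤ 4 * u + (1652 + 920 * c) * (u * v) := by
  have hcv : 0 ≤ c * v := mul_nonneg hc hv0
  have hcuv : c * u * v ≤ c * (1 / 2) * v := by nlinarith [mul_nonneg hc hv0]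
  have h1 : (1 + 8 * u) * (1 + c * v) ≤ 1 + (8 + 5 * c) * v := by nlinarith
  have h2 : 4 * u + 180 * u ^ 2 ≤ 4 * u + 180 * (u * v) := by nlinarith
  have h4 : 0 ≤ 4 * u + 180 * u ^ 2 := by positivity
  have huv0 : 0 ≤ u * v := mul_nonneg hu0 hv0
  calc (1 + 8 * u) * (1 + c * v) * (4 * u + 180 * u ^ 2)
      ≤ (1 + (8 + 5 * c) * v) * (4 * u + 180 * (u * v)) := mul_le_mul h1 h2 h4 (by positivity)
    _ = 4 * u + (180 + 4 * (8 + 5 * c)) * (u * v) + 180 * (8 + 5 * c) * ((u * v) * v) := by ring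
    _ ≤ 4 * u + (180 + 4 * (8 + 5 * c)) * (u * v) + 180 * (8 + 5 * c) * (u * v) := by
        have : (u * v) * v ≤ u * v := by nlinarith
        have h85 : 0 ≤ 180 * (8 + 5 * c) := by positivity
        nlinarith
    _ = 4 * u + (1652 + 920 * c) * (u * v) := by ring

/-- The facts about `u = 1/p`, `v = p^{−9/10}` at a prime `p`: `0 ≤ u ≤ 1/2`, `0 ≤ v ≤ 1`, `u ≤ v`,
`uv = p^{−19/10}`. [folklore] -/
private theorem prime_uv_facts {p : ℕ} (hp : p.Prime) :
    0 ≤ 1 / (p : ℝ) ∧ 1 / (p : ℝ) ≤ 1 / 2 ∧ 0 ≤ (p : ℝ) ^ (-(9 / 10 : ℝ)) ∧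
      (p : ℝ) ^ (-(9 / 10 : ℝ)) ≤ 1 ∧ 1 / (p : ℝ) ≤ (p : ℝ) ^ (-(9 / 10 : ℝ)) ∧
        1 / (p : ℝ) * (p : ℝ) ^ (-(9 / 10 : ℝ)) = (p : ℝ) ^ (-(19 / 10 : ℝ)) := by
  have hp2 : (2 : ℝ) ≤ p := by exact_mod_cast hp.two_le
  have hp1 : (1 : ℝ) ≤ p := by linarith
  have hp0 : (0 : ℝ) < p := by linarith
  refine ⟨by positivity, one_div_le_one_div_of_le (by norm_num) hp2, Real.rpow_nonneg hp0.le _,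
    Real.rpow_le_one_of_one_le_of_nonpos hp1 (by norm_num), ?_, ?_⟩
  · rw [one_div, ← Real.rpow_neg_one]
    exact Real.rpow_le_rpow_of_exponent_le hp1 (by norm_num)
  · rw [one_div, ← Real.rpow_neg_one, ← Real.rpow_add hp0]; norm_num

open scoped Classical in
/-- **The smooth part: `S₁ = Σ_{n∈𝒩(𝒬), n<T} τ₂(n)‖ϖ₁ⱼ(n)‖/n ≤ K𝓛⁴`** for all large `D`, under (A),
`1 ≤ j ≤ 3`. The pointwise bound `norm_varpi1_le_of_bounds` (§15.u035 + Lemma 15.2) makes the summand at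
most `2|C|·τ₂(n)²∏_{q∣n}w(q)/n`, `w(q) = (1+8/q)(1+|c|q^{−9/10})`; the Euler-product majorant over the
`D⁴`-smooth numbers (`EulerMajorant.sum_tauSqW_le_exp`) and Mertens (`Σ_{p<D⁴}1/p ≤ log log D⁴ + 4`)
give `exp(4 log log D⁴ + O(1)) = O(𝓛⁴)`. [cite: Zhang2022LandauSiegel, §15 p.87] -/
theorem smooth_part_le (c' : ℝ) :
    ∃ K : ℝ, ForAllLarge fun D _ χ => AssumptionA D χ → ∀ j ∈ ({1, 2, 3} : Finset ℕ),
      ∑ n ∈ (Finset.Ico 1 ⌈bigT D⌉₊).filter (fun n => n ∈ nset (frakq D)),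
          (n.divisors.card : ℝ) * ‖varpi1 c' χ j n‖ / n ≤ K * ell D ^ 4 := by
  classical
  obtain ⟨c₀, C₀, h35⟩ := Section15B.step15_u035_holds c'
  set Kw : ℝ := 1652 + 920 * |c₀| with hKw
  set Z : ℝ := ∑' n : ℕ, (n : ℝ) ^ (-(19 / 10 : ℝ)) with hZ
  set K : ℝ := 2 * |C₀| * (256 * Real.exp (16 + Kw * Z)) with hK
  refine ⟨K, ?_⟩
  have hT : ForAllLarge fun D _ _ => (2 : ℕ) ≤ D := ForAllLarge.of_le 2 fun _ _ _ hD _ _ => hD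
  refine ((h35.and (Section15B.norm_calM1_one_one_betaJ_ge c')).and hT).mono
    fun D _ χ _ _ h hA j hj => ?_
  obtain ⟨⟨g35, gM⟩, hD2⟩ := h
  obtain ⟨-, hsre1, hM⟩ := gM hA j hj
  have hsre : 9 / 10 < (1 - betaJ c' D j).re := by rw [hsre1]; norm_num
  have h35' : ∀ d l : ℕ, 1 ≤ d → 1 ≤ l → ‖calM1 c' χ d l (1 - betaJ c' D j)‖ ≤
      C₀ * ∏ q ∈ (d * l).primeFactors, (1 + c₀ * (q : ℝ) ^ (-(9 / 10 : ℝ))) :=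
    fun d l hd hl => g35 hA d l hd hl _ hsre
  -- the weight and the termwise comparison with `t_w`
  set w : ℕ → ℝ := fun q => (1 + 8 / (q : ℝ)) * (1 + |c₀| * (q : ℝ) ^ (-(9 / 10 : ℝ))) with hw
  have hw0 : ∀ q, 0 ≤ w q := fun q => by
    have : 0 ≤ (q : ℝ) ^ (-(9 / 10 : ℝ)) := Real.rpow_nonneg (Nat.cast_nonneg q) _
    rw [hw]; positivity
  set S := (Finset.Ico 1 ⌈bigT D⌉₊).filter (fun n => n ∈ nset (frakq D)) with hS
  have hpt : ∀ n ∈ S, (n.divisors.card : ℝ) * ‖varpi1 c' χ j n‖ / n ≤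
      2 * |C₀| * (((n.divisors.card : ℝ) ^ 2 * ∏ q ∈ n.primeFactors, w q) / n) := by
    intro n hn
    rw [hS, Finset.mem_filter, Finset.mem_Ico] at hn
    have hn0 : n ≠ 0 := by omega
    have h := norm_varpi1_le_of_bounds c' χ j h35' hM hn0
    have h1 : (n.divisors.card : ℝ) * ‖varpi1 c' χ j n‖ ≤ (n.divisors.card : ℝ) *
        (2 * |C₀| * (n.divisors.card : ℝ) * ∏ q ∈ n.primeFactors, w q) :=
      mul_le_mul_of_nonneg_left h (Nat.cast_nonneg _)
    calc (n.divisors.card : ℝ) * ‖varpi1 c' χ j n‖ / n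
        ≤ (n.divisors.card : ℝ) * (2 * |C₀| * (n.divisors.card : ℝ) * ∏ q ∈ n.primeFactors, w q) / n :=
          div_le_div_of_nonneg_right h1 (Nat.cast_nonneg n)
      _ = 2 * |C₀| * (((n.divisors.card : ℝ) ^ 2 * ∏ q ∈ n.primeFactors, w q) / n) := by ring
  -- the smooth numbers below `T` are `primesBelow(D⁴)`-factored
  have hF : ∀ n ∈ S, n ∈ Nat.factoredNumbers (Nat.primesBelow (D ^ 4)) := by
    intro n hn
    rw [hS, Finset.mem_filter, Finset.mem_Ico] at hn
    rw [Nat.mem_factoredNumbers_iff_primeFactors_subset]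
    refine ⟨by omega, fun q hq => ?_⟩
    have hqP := Nat.prime_of_mem_primeFactors hq
    have hqQ : q ∣ frakq D := hn.2.2 q hqP (Nat.dvd_of_mem_primeFactors hq)
    exact Nat.mem_primesBelow.mpr ⟨(Section15B.prime_dvd_frakq_iff hqP).mp hqQ, hqP⟩
  have hmaj := EulerMajorant.sum_tauSqW_le_exp hw0 (Nat.primesBelow (D ^ 4)) S hF
  -- the exponent: `Σ_{p<D⁴} w(p)(4/p + 180/p²) ≤ 4(log log D⁴ + 4) + Kw·Z`
  have hfilt : (Nat.primesBelow (D ^ 4)).filter Nat.Prime = Nat.primesBelow (D ^ 4) :=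
    Finset.filter_true_of_mem fun p hp => (Nat.mem_primesBelow.mp hp).2
  have hD4 : 2 ≤ D ^ 4 := le_trans hD2 (Nat.le_self_pow (by norm_num) D)
  have hZs : Summable (fun n : ℕ => (n : ℝ) ^ (-(19 / 10 : ℝ))) :=
    Real.summable_nat_rpow.mpr (by norm_num)
  have hexp_le : ∑ p ∈ (Nat.primesBelow (D ^ 4)).filter Nat.Prime, w p * (4 / p + 180 / (p : ℝ) ^ 2) ≤
      4 * (Real.log (Real.log ((D ^ 4 : ℕ) : ℝ)) + 4) + Kw * Z := by
    rw [hfilt]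
    have hterm : ∀ p ∈ Nat.primesBelow (D ^ 4), w p * (4 / p + 180 / (p : ℝ) ^ 2) ≤
        4 * (1 / (p : ℝ)) + Kw * (p : ℝ) ^ (-(19 / 10 : ℝ)) := by
      intro p hp
      have hpP := (Nat.mem_primesBelow.mp hp).2
      obtain ⟨hu0, hu, hv0, hv1, huv, huvp⟩ := prime_uv_facts hpP
      have h := weight_term_le hu0 hu hv0 hv1 huv (abs_nonneg c₀)
      rw [huvp] at h
      have e1 : w p * (4 / p + 180 / (p : ℝ) ^ 2) =
          (1 + 8 * (1 / (p : ℝ))) * (1 + |c₀| * (p : ℝ) ^ (-(9 / 10 : ℝ))) *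
            (4 * (1 / (p : ℝ)) + 180 * (1 / (p : ℝ)) ^ 2) := by
        rw [hw]; ring
      rw [e1]
      exact h
    refine (Finset.sum_le_sum hterm).trans ?_
    rw [Finset.sum_add_distrib, ← Finset.mul_sum, ← Finset.mul_sum]
    have h1 := EulerMajorant.sum_inv_primesBelow_le hD4
    have h2 : ∑ p ∈ Nat.primesBelow (D ^ 4), (p : ℝ) ^ (-(19 / 10 : ℝ)) ≤ Z :=
      hZs.sum_le_tsum _ fun n _ => Real.rpow_nonneg (Nat.cast_nonneg n) _
    have hKw0 : 0 ≤ Kw := by rw [hKw]; positivity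
    nlinarith
  -- evaluate `exp(4 log log D⁴ + 16 + Kw Z) = 256 𝓛⁴ e^{16 + Kw Z}`
  have hD0 : (0 : ℝ) < D := by exact_mod_cast (show 0 < D by omega)
  have hℓ0 : 0 < ell D := Real.log_pos (by exact_mod_cast (show 1 < D by omega))
  have hlog4 : Real.log ((D ^ 4 : ℕ) : ℝ) = 4 * ell D := by
    push_cast; rw [Real.log_pow, ell]; push_cast; ring
  have hexp_val : Real.exp (4 * (Real.log (Real.log ((D ^ 4 : ℕ) : ℝ)) + 4) + Kw * Z) =
      256 * Real.exp (16 + Kw * Z) * ell D ^ 4 := by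
    rw [hlog4, show 4 * (Real.log (4 * ell D) + 4) + Kw * Z =
      (4 : ℕ) * Real.log (4 * ell D) + (16 + Kw * Z) by push_cast; ring, Real.exp_add,
      Real.exp_nat_mul, Real.exp_log (by positivity)]
    ring
  calc ∑ n ∈ S, (n.divisors.card : ℝ) * ‖varpi1 c' χ j n‖ / n
      ≤ ∑ n ∈ S, 2 * |C₀| * (((n.divisors.card : ℝ) ^ 2 * ∏ q ∈ n.primeFactors, w q) / n) :=
        Finset.sum_le_sum hpt
    _ = 2 * |C₀| * ∑ n ∈ S, ((n.divisors.card : ℝ) ^ 2 * ∏ q ∈ n.primeFactors, w q) / n := by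
        rw [Finset.mul_sum]
    _ ≤ 2 * |C₀| * Real.exp (4 * (Real.log (Real.log ((D ^ 4 : ℕ) : ℝ)) + 4) + Kw * Z) := by
        refine mul_le_mul_of_nonneg_left (hmaj.trans (Real.exp_le_exp.mpr hexp_le)) (by positivity)
    _ = K * ell D ^ 4 := by rw [hexp_val, hK]; ring

end Smooth

/-! ## §3. The rough part `S₂ ≪ 𝓛⁻⁵` -/

section Rough

/-- Size facts at a large modulus (`𝓛 = log D ≥ 10`): `D ≥ 2`, `𝓛 ≥ 10 > 0`, `T = exp 𝓛^{1.1} ≥ D + 1`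
(since `𝓛^{1.1} ≥ 𝓛(1 + log 𝓛/10) ≥ 𝓛 + 1`), `𝓛^{1.1} ≤ 𝓛²`, `T ≤ P/T³` (`4𝓛^{1.1} ≤ 𝓛⁹`) and
`T ≤ exp(2𝓛⁹) = P²`. [cite: Zhang2022LandauSiegel, §2 (2.1), §6 p.12] -/
theorem sizes_of_ten_le_ell {D : ℕ} (hℓ : 10 ≤ ell D) :
    2 ≤ D ∧ 0 < ell D ∧ ell D ^ (1.1 : ℝ) ≤ ell D ^ 2 ∧ (D : ℝ) + 1 ≤ bigT D ∧
      bigT D ≤ bigP D / bigT D ^ 3 ∧ bigT D ≤ Real.exp (2 * Real.log D ^ 9) := by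
  have hℓ0 : 0 < ell D := by linarith
  have hℓ1 : 1 ≤ ell D := by linarith
  have hD1 : (1 : ℝ) < D := by
    by_contra h
    have : ell D ≤ 0 := Real.log_nonpos (by exact_mod_cast Nat.zero_le D) (not_lt.mp h)
    linarith
  have hD2 : 2 ≤ D := by exact_mod_cast (show (1 : ℝ) < D from hD1)
  have hD0 : (0 : ℝ) < D := by linarith
  -- `𝓛^{1.1} ≤ 𝓛²`
  have h11 : ell D ^ (1.1 : ℝ) ≤ ell D ^ 2 := by
    calc ell D ^ (1.1 : ℝ) ≤ ell D ^ (2 : ℝ) := Real.rpow_le_rpow_of_exponent_le hℓ1 (by norm_num)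
      _ = ell D ^ 2 := by norm_cast
  -- `𝓛^{1.1} ≥ 𝓛 + 1`
  have hlog10 : 1 ≤ Real.log (ell D) := by
    rw [Real.le_log_iff_exp_le hℓ0]
    have := Real.exp_one_lt_d9
    linarith
  have h01 : 1 + (1 / 10) * Real.log (ell D) ≤ ell D ^ ((1 : ℝ) / 10) := by
    rw [Real.rpow_def_of_pos hℓ0]
    have := Real.add_one_le_exp (Real.log (ell D) * (1 / 10))
    linarith
  have hpow : ell D + 1 ≤ ell D ^ (1.1 : ℝ) := by
    have e : ell D ^ (1.1 : ℝ) = ell D ^ (1 : ℝ) * ell D ^ ((1 : ℝ) / 10) := by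
      rw [← Real.rpow_add hℓ0]; norm_num
    rw [e, Real.rpow_one]
    have h2 : ell D * (1 + (1 / 10) * Real.log (ell D)) ≤ ell D * ell D ^ ((1 : ℝ) / 10) :=
      mul_le_mul_of_nonneg_left h01 hℓ0.le
    nlinarith
  have hT : (D : ℝ) + 1 ≤ bigT D := by
    rw [bigT]
    have h1 : Real.exp (ell D + 1) ≤ Real.exp (ell D ^ (1.1 : ℝ)) := Real.exp_le_exp.mpr hpow
    have hexpℓ : Real.exp (ell D) = D := by rw [ell, Real.exp_log hD0]
    rw [Real.exp_add, hexpℓ] at h1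
    have he : (2 : ℝ) ≤ Real.exp 1 := by
      have := Real.add_one_le_exp (1 : ℝ); linarith
    nlinarith
  -- `T⁴ ≤ P`
  have hT0 : 0 < bigT D := Real.exp_pos _
  have h4 : 4 * ell D ^ (1.1 : ℝ) ≤ ell D ^ 9 := by
    have h7 : (128 : ℝ) ≤ ell D ^ 7 := by
      calc (128 : ℝ) = 2 ^ 7 := by norm_num
        _ ≤ ell D ^ 7 := pow_le_pow_left₀ (by norm_num) (by linarith) 7
    calc 4 * ell D ^ (1.1 : ℝ) ≤ 4 * ell D ^ 2 := by linarith
      _ ≤ ell D ^ 2 * ell D ^ 7 := by nlinarith [pow_nonneg hℓ0.le 2]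
      _ = ell D ^ 9 := by ring
  have hTP : bigT D ≤ bigP D / bigT D ^ 3 := by
    rw [le_div_iff₀ (pow_pos hT0 3)]
    calc bigT D * bigT D ^ 3 = Real.exp (4 * ell D ^ (1.1 : ℝ)) := by
          rw [bigT, ← Real.exp_nat_mul, ← Real.exp_add]; ring_nf
      _ ≤ Real.exp (ell D ^ 9) := Real.exp_le_exp.mpr h4
      _ = bigP D := by rw [bigP]
  have hTP2 : bigT D ≤ Real.exp (2 * Real.log D ^ 9) := by
    rw [bigT]
    refine Real.exp_le_exp.mpr ?_
    have : ell D ^ 2 ≤ ell D ^ 9 := pow_le_pow_right₀ hℓ1 (by norm_num)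
    rw [← ell]
    nlinarith [pow_nonneg hℓ0.le 9]
  exact ⟨hD2, hℓ0, h11, hT, hTP, hTP2⟩

/-- `⌈T⌉₊ − 1 ≤ T` and `D ≤ ⌈T⌉₊ − 1` when `D + 1 ≤ T`. [folklore] -/
private theorem ceil_facts {D : ℕ} (hT : (D : ℝ) + 1 ≤ bigT D) :
    D ≤ ⌈bigT D⌉₊ - 1 ∧ 1 ≤ ⌈bigT D⌉₊ ∧ (((⌈bigT D⌉₊ - 1 : ℕ) : ℝ)) ≤ bigT D := by
  have hT0 : 0 ≤ bigT D := (Real.exp_pos _).le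
  have h1 : D + 1 ≤ ⌈bigT D⌉₊ := by
    have : ((D + 1 : ℕ) : ℝ) ≤ bigT D := by push_cast; exact hT
    exact_mod_cast this.trans (Nat.le_ceil _)
  have hN1 : 1 ≤ ⌈bigT D⌉₊ := le_trans (by omega) h1
  refine ⟨by omega, hN1, ?_⟩
  have h2 : (⌈bigT D⌉₊ : ℝ) < bigT D + 1 := Nat.ceil_lt_add_one hT0
  rw [Nat.cast_sub hN1]
  push_cast
  linarith

open scoped Classical in
/-- **`Σ_{(n,𝒬)=1, n<T} τ₂(n)²/n ≤ e²⁷⁶·𝓛`** for `𝓛 ≥ 10`: the numbers `< T` coprime to `𝒬` are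
`(D, ⌈T⌉−1]`-factored (all prime factors `≥ D⁴`), so the Euler-product majorant
(`EulerMajorant.sum_tauSqW_le_exp`, weight `1`) and the window form of Mertens
(`Σ_{D<p≤T} 1/p ≤ log log T − log log D + 24 = 0.1 log 𝓛 + 24`) bound the sum by
`exp(0.4 log 𝓛 + 276) ≤ e²⁷⁶𝓛`. [cite: Zhang2022LandauSiegel, §15 p.87] -/
theorem rough_tauSq_sum_le {D : ℕ} (hℓ : 10 ≤ ell D) :
    ∑ n ∈ (Finset.Ico 1 ⌈bigT D⌉₊).filter (fun n => Nat.Coprime n (frakq D)),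
        (n.divisors.card : ℝ) ^ 2 / n ≤ Real.exp 276 * ell D := by
  obtain ⟨hD2, hℓ0, h11, hT, -, -⟩ := sizes_of_ten_le_ell hℓ
  obtain ⟨hDN, hN1, hNT⟩ := ceil_facts hT
  set N := ⌈bigT D⌉₊ with hN
  set F := (Finset.Ico 1 N).filter (fun n => Nat.Coprime n (frakq D)) with hFdef
  -- the rough numbers are `Ioc D (N-1)`-factored
  have hF : ∀ n ∈ F, n ∈ Nat.factoredNumbers (Finset.Ioc D (N - 1)) := by
    intro n hn
    rw [hFdef, Finset.mem_filter, Finset.mem_Ico] at hn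
    rw [Nat.mem_factoredNumbers_iff_primeFactors_subset]
    refine ⟨by omega, fun q hq => ?_⟩
    have hq4 := Section15B.pow_four_le_of_mem_primeFactors_of_coprime_frakq hn.2 hq
    have hD4 : D < D ^ 4 := by
      calc D = D ^ 1 := (pow_one D).symm
        _ < D ^ 4 := Nat.pow_lt_pow_right (by omega) (by norm_num)
    have hqn : q ≤ n := Nat.le_of_dvd (by omega) (Nat.dvd_of_mem_primeFactors hq)
    rw [Finset.mem_Ioc]
    exact ⟨lt_of_lt_of_le hD4 hq4, by omega⟩
  have hmaj := EulerMajorant.sum_tauSqW_le_exp (w := fun _ => (1 : ℝ)) (fun _ => zero_le_one)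
    (Finset.Ioc D (N - 1)) F hF
  simp only [Finset.prod_const_one, mul_one, one_mul] at hmaj
  refine hmaj.trans ?_
  -- the exponent
  have hsum1 : ∑ p ∈ (Finset.Ioc D (N - 1)).filter Nat.Prime, (1 : ℝ) / p ≤
      Real.log (Real.log ((N - 1 : ℕ) : ℝ)) - Real.log (Real.log D) + 24 :=
    EulerMajorant.sum_inv_primes_Ioc_le hD2 hDN
  have hsum2 : ∑ p ∈ (Finset.Ioc D (N - 1)).filter Nat.Prime, (180 : ℝ) / (p : ℝ) ^ 2 ≤ 180 := by
    have hsub : (Finset.Ioc D (N - 1)).filter Nat.Prime ⊆ Finset.Ioo D N := by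
      intro p hp
      rw [Finset.mem_filter, Finset.mem_Ioc] at hp
      rw [Finset.mem_Ioo]
      exact ⟨hp.1.1, by omega⟩
    have h1 : ∑ p ∈ (Finset.Ioc D (N - 1)).filter Nat.Prime, ((p : ℝ) ^ 2)⁻¹ ≤
        ∑ i ∈ Finset.Ioo D N, ((i : ℝ) ^ 2)⁻¹ :=
      Finset.sum_le_sum_of_subset_of_nonneg hsub fun i _ _ => by positivity
    have h2 := sum_Ioo_inv_sq_le (α := ℝ) D N
    have h3 : (2 : ℝ) / (D + 1) ≤ 1 := by
      rw [div_le_one (by positivity)]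
      have : (2 : ℝ) ≤ D := by exact_mod_cast hD2
      linarith
    calc ∑ p ∈ (Finset.Ioc D (N - 1)).filter Nat.Prime, (180 : ℝ) / (p : ℝ) ^ 2
        = 180 * ∑ p ∈ (Finset.Ioc D (N - 1)).filter Nat.Prime, ((p : ℝ) ^ 2)⁻¹ := by
          rw [Finset.mul_sum]; refine Finset.sum_congr rfl fun p _ => ?_; rw [div_eq_mul_inv]
      _ ≤ 180 * 1 := by nlinarith [h1.trans (h2.trans h3)]
      _ = 180 := by ring
  -- `log log (N−1) ≤ 1.1 log 𝓛`, `log log D = log 𝓛`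
  have hN1' : (1 : ℝ) < ((N - 1 : ℕ) : ℝ) := by
    have : (2 : ℝ) ≤ ((N - 1 : ℕ) : ℝ) := by exact_mod_cast le_trans hD2 hDN
    linarith
  have hloglog : Real.log (Real.log ((N - 1 : ℕ) : ℝ)) ≤ (1.1 : ℝ) * Real.log (ell D) := by
    have h1 : Real.log ((N - 1 : ℕ) : ℝ) ≤ ell D ^ (1.1 : ℝ) := by
      calc Real.log ((N - 1 : ℕ) : ℝ) ≤ Real.log (bigT D) := Real.log_le_log (by linarith) hNT
        _ = ell D ^ (1.1 : ℝ) := by rw [bigT, Real.log_exp]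
    have h2 : 0 < Real.log ((N - 1 : ℕ) : ℝ) := Real.log_pos hN1'
    calc Real.log (Real.log ((N - 1 : ℕ) : ℝ)) ≤ Real.log (ell D ^ (1.1 : ℝ)) := Real.log_le_log h2 h1
      _ = (1.1 : ℝ) * Real.log (ell D) := Real.log_rpow hℓ0 _
  have hlogL : 0 ≤ Real.log (ell D) := Real.log_nonneg (by linarith)
  have hexp : ∑ p ∈ (Finset.Ioc D (N - 1)).filter Nat.Prime, (4 / (p : ℝ) + 180 / (p : ℝ) ^ 2) ≤
      Real.log (ell D) + 276 := by
    rw [Finset.sum_add_distrib]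
    have h4 : ∑ p ∈ (Finset.Ioc D (N - 1)).filter Nat.Prime, (4 : ℝ) / p =
        4 * ∑ p ∈ (Finset.Ioc D (N - 1)).filter Nat.Prime, (1 : ℝ) / p := by
      rw [Finset.mul_sum]; refine Finset.sum_congr rfl fun p _ => ?_; ring
    rw [h4]
    have : Real.log (Real.log (D : ℝ)) = Real.log (ell D) := by rw [ell]
    rw [this] at hsum1
    nlinarith
  calc Real.exp (∑ p ∈ (Finset.Ioc D (N - 1)).filter Nat.Prime, (4 / (p : ℝ) + 180 / (p : ℝ) ^ 2))
      ≤ Real.exp (Real.log (ell D) + 276) := Real.exp_le_exp.mpr hexp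
    _ = Real.exp 276 * ell D := by rw [Real.exp_add, Real.exp_log hℓ0]; ring

/-- **`‖ϱ*ⱼ(n) − ν(n)‖ ≤ τ₂(n)·|bⱼ|·log n`** for `n ≥ 1`, `βⱼ = ibⱼ`: `ϱ*ⱼ(n) − ν(n) =
Σ_{d∣n}(d^{βⱼ} − 1)χ(d)` and `|d^{ibⱼ} − 1| ≤ |bⱼ|log d ≤ |bⱼ|log n` (tree `norm_powI_sub_one_le`).
[cite: Zhang2022LandauSiegel, §15 p.87] -/
theorem norm_varrhoStar_sub_nu_le (c' : ℝ) {D : ℕ} (χ : DirichletCharacter ℂ D) (j : ℕ) {b : ℝ}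
    (hb : betaJ c' D j = (b : ℂ) * I) (n : ℕ) :
    ‖varrhoStar c' χ j n - nu χ n‖ ≤ (n.divisors.card : ℝ) * (|b| * Real.log n) := by
  have hdiff : varrhoStar c' χ j n - nu χ n =
      ∑ d ∈ n.divisors, ((d : ℂ) ^ betaJ c' D j - 1) * χ (d : ZMod D) := by
    rw [varrhoStar, nu, Literature.NumberTheory.LFunctions.divisorSumChar_apply,
      ← Finset.sum_sub_distrib]
    refine Finset.sum_congr rfl fun d _ => ?_
    ring
  rw [hdiff]
  refine (norm_sum_le _ _).trans ?_
  have hterm : ∀ d ∈ n.divisors, ‖((d : ℂ) ^ betaJ c' D j - 1) * χ (d : ZMod D)‖ ≤ |b| * Real.log n := by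
    intro d hd
    have hd0 : 0 < d := Nat.pos_of_mem_divisors hd
    have hdn : d ≤ n := Nat.divisor_le hd
    rw [norm_mul, natCast_cpow_betaJ_eq_powI c' j hd0 hb]
    have h1 := MeanSquareMajorant.norm_powI_sub_one_le (-b) hd0
    rw [abs_neg] at h1
    have h2 : Real.log d ≤ Real.log n :=
      Real.log_le_log (by exact_mod_cast hd0) (by exact_mod_cast hdn)
    have hχ : ‖χ (d : ZMod D)‖ ≤ 1 := χ.norm_le_one _
    have h0 : 0 ≤ ‖MeanSquareMajorant.powI (-b) d - 1‖ := norm_nonneg _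
    calc ‖MeanSquareMajorant.powI (-b) d - 1‖ * ‖χ (d : ZMod D)‖
        ≤ (|b| * Real.log d) * 1 := mul_le_mul h1 hχ (norm_nonneg _) (by positivity)
      _ ≤ |b| * Real.log n := by rw [mul_one]; exact mul_le_mul_of_nonneg_left h2 (abs_nonneg b)
  calc ∑ d ∈ n.divisors, ‖((d : ℂ) ^ betaJ c' D j - 1) * χ (d : ZMod D)‖
      ≤ ∑ d ∈ n.divisors, |b| * Real.log n := Finset.sum_le_sum hterm
    _ = (n.divisors.card : ℝ) * (|b| * Real.log n) := by rw [Finset.sum_const, nsmul_eq_mul]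

/-- **The rough-part summand, pointwise** (for `1 ≤ n < T`, given (15.21) at `n` and `βⱼ = ibⱼ`):
`τ₂(n)‖ϖ₁ⱼ(n)‖/n ≤ |bⱼ|𝓛^{1.1}·τ₂(n)²/n + τ₂(n)‖ν(n)‖/n + |C|D⁻ᶜ·τ₂(n)²/n`, from
`‖ϖ₁ⱼ(n)‖ ≤ ‖ϱ*ⱼ(n)‖ + Cτ₂(n)D⁻ᶜ` and `‖ϱ*ⱼ(n)‖ ≤ τ₂(n)|bⱼ|log T + ‖ν(n)‖` (`log T = 𝓛^{1.1}`).
[cite: Zhang2022LandauSiegel, §15 p.87] -/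
theorem rough_pointwise (c' : ℝ) {D : ℕ} [NeZero D] (χ : DirichletCharacter ℂ D) (j : ℕ)
    {b c C : ℝ} (hb : betaJ c' D j = (b : ℂ) * I) {n : ℕ} (hn : 1 ≤ n) (hnT : (n : ℝ) < bigT D)
    (h21 : ‖varpi1 c' χ j n - χ (n : ZMod D) * varrhoStar c' χ j n‖ ≤
      C * (n.divisors.card : ℝ) * (D : ℝ) ^ (-c)) :
    (n.divisors.card : ℝ) * ‖varpi1 c' χ j n‖ / n ≤
      (|b| * ell D ^ (1.1 : ℝ)) * ((n.divisors.card : ℝ) ^ 2 / n) +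
        (n.divisors.card : ℝ) * ‖nu χ n‖ / n +
        |C| * (D : ℝ) ^ (-c) * ((n.divisors.card : ℝ) ^ 2 / n) := by
  have hn0 : n ≠ 0 := by omega
  have hnpos : (0 : ℝ) < n := by exact_mod_cast Nat.pos_of_ne_zero hn0
  have hτ0 : 0 ≤ (n.divisors.card : ℝ) := Nat.cast_nonneg _
  have hDc : 0 ≤ (D : ℝ) ^ (-c) := Real.rpow_nonneg (Nat.cast_nonneg D) _
  have hlog : Real.log n ≤ ell D ^ (1.1 : ℝ) := by
    calc Real.log n ≤ Real.log (bigT D) := Real.log_le_log hnpos hnT.le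
      _ = ell D ^ (1.1 : ℝ) := by rw [bigT, Real.log_exp]
  -- `‖ϖ‖ ≤ ‖ϱ*‖ + |C|τD⁻ᶜ`
  have h1 : ‖varpi1 c' χ j n‖ ≤ ‖varrhoStar c' χ j n‖ +
      |C| * (n.divisors.card : ℝ) * (D : ℝ) ^ (-c) := by
    have e := norm_sub_norm_le (varpi1 c' χ j n) (χ (n : ZMod D) * varrhoStar c' χ j n)
    have hχ : ‖χ (n : ZMod D) * varrhoStar c' χ j n‖ ≤ ‖varrhoStar c' χ j n‖ := by
      rw [norm_mul]
      have := χ.norm_le_one (n : ZMod D)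
      have h0 := norm_nonneg (varrhoStar c' χ j n)
      nlinarith
    have hC : C * (n.divisors.card : ℝ) * (D : ℝ) ^ (-c) ≤
        |C| * (n.divisors.card : ℝ) * (D : ℝ) ^ (-c) := by
      have := le_abs_self C
      have h0 : 0 ≤ (n.divisors.card : ℝ) * (D : ℝ) ^ (-c) := mul_nonneg hτ0 hDc
      nlinarith
    linarith
  -- `‖ϱ*‖ ≤ τ|b|𝓛^{1.1} + ‖ν‖`
  have h2 : ‖varrhoStar c' χ j n‖ ≤ (n.divisors.card : ℝ) * (|b| * ell D ^ (1.1 : ℝ)) + ‖nu χ n‖ := by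
    have e := norm_sub_norm_le (varrhoStar c' χ j n) (nu χ n)
    have h3 := norm_varrhoStar_sub_nu_le c' χ j hb n
    have h4 : (n.divisors.card : ℝ) * (|b| * Real.log n) ≤
        (n.divisors.card : ℝ) * (|b| * ell D ^ (1.1 : ℝ)) :=
      mul_le_mul_of_nonneg_left (mul_le_mul_of_nonneg_left hlog (abs_nonneg b)) hτ0
    linarith
  have h3 : ‖varpi1 c' χ j n‖ ≤ (n.divisors.card : ℝ) * (|b| * ell D ^ (1.1 : ℝ)) + ‖nu χ n‖ +
      |C| * (n.divisors.card : ℝ) * (D : ℝ) ^ (-c) := by linarith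
  have h4 := mul_le_mul_of_nonneg_left h3 hτ0
  have h5 := div_le_div_of_nonneg_right h4 hnpos.le
  refine h5.trans (le_of_eq ?_)
  field_simp

open scoped Classical in
/-- **The `ν`-part by Cauchy–Schwarz and Lemma 3.1**: for `𝓛 ≥ 10`,
`Σ_{1<n<T,(n,𝒬)=1} τ₂(n)‖ν(n)‖/n ≤ (Σ_{(n,𝒬)=1,n<T} τ₂(n)²/n)^{1/2}·(C₃₁𝓛⁻²⁰¹¹)^{1/2}`, since every
such `n` exceeds `D⁴` and Lemma 3.1 gives `Σ_{D⁴<n≤T}‖ν(n)‖²/n ≤ C₃₁𝓛⁻²⁰¹¹` (`T ≤ P²`).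
[cite: Zhang2022LandauSiegel, §3 Lemma 3.1, §15 p.87] -/
theorem nu_part_le {D : ℕ} (χ : DirichletCharacter ℂ D) {C₃₁ : ℝ} (hℓ : 10 ≤ ell D)
    (h31 : ∀ M : ℕ, (M : ℝ) ≤ Real.exp (2 * Real.log D ^ 9) →
      ∑ n ∈ Finset.Ioc (D ^ 4) M, ‖nu χ n‖ ^ 2 / n ≤ C₃₁ / Real.log D ^ 2011) :
    ∑ n ∈ (Finset.Ico 2 ⌈bigT D⌉₊).filter (fun n => Nat.Coprime n (frakq D)),
        (n.divisors.card : ℝ) * ‖nu χ n‖ / n ≤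
      Real.sqrt (∑ n ∈ (Finset.Ico 1 ⌈bigT D⌉₊).filter (fun n => Nat.Coprime n (frakq D)),
          (n.divisors.card : ℝ) ^ 2 / n) * Real.sqrt (C₃₁ / ell D ^ 2011) := by
  obtain ⟨hD2, hℓ0, -, hT, -, hTP2⟩ := sizes_of_ten_le_ell hℓ
  obtain ⟨hDN, hN1, hNT⟩ := ceil_facts hT
  set N := ⌈bigT D⌉₊ with hN
  set B := (Finset.Ico 2 N).filter (fun n => Nat.Coprime n (frakq D)) with hB
  set B' := (Finset.Ico 1 N).filter (fun n => Nat.Coprime n (frakq D)) with hB'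
  set f : ℕ → ℝ := fun n => (n.divisors.card : ℝ) ^ 2 / n with hf
  set g : ℕ → ℝ := fun n => ‖nu χ n‖ ^ 2 / n with hg
  have hf0 : ∀ n, 0 ≤ f n := fun n => by rw [hf]; positivity
  have hg0 : ∀ n, 0 ≤ g n := fun n => by rw [hg]; positivity
  have hterm : ∀ n ∈ B, (n.divisors.card : ℝ) * ‖nu χ n‖ / n = Real.sqrt (f n) * Real.sqrt (g n) := by
    intro n hn
    rw [hB, Finset.mem_filter, Finset.mem_Ico] at hn
    have hn0 : (0 : ℝ) < n := by exact_mod_cast (show 0 < n by omega)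
    rw [hf, hg]
    simp only
    rw [Real.sqrt_div (sq_nonneg _), Real.sqrt_div (sq_nonneg _), Real.sqrt_sq (Nat.cast_nonneg _),
      Real.sqrt_sq (norm_nonneg _), div_mul_div_comm, Real.mul_self_sqrt hn0.le]
  rw [Finset.sum_congr rfl hterm]
  refine (Real.sum_sqrt_mul_sqrt_le B hf0 hg0).trans ?_
  -- `Σ_B f ≤ Σ_{B'} f`
  have hsubB : B ⊆ B' := by
    intro n hn
    rw [hB, Finset.mem_filter, Finset.mem_Ico] at hn
    rw [hB', Finset.mem_filter, Finset.mem_Ico]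
    exact ⟨⟨by omega, hn.1.2⟩, hn.2⟩
  have hfB : ∑ n ∈ B, f n ≤ ∑ n ∈ B', f n :=
    Finset.sum_le_sum_of_subset_of_nonneg hsubB fun n _ _ => hf0 n
  -- `Σ_B g ≤ Σ_{D⁴<n≤N-1} g ≤ C₃₁/𝓛^{2011}`
  have hsubI : B ⊆ Finset.Ioc (D ^ 4) (N - 1) := by
    intro n hn
    rw [hB, Finset.mem_filter, Finset.mem_Ico] at hn
    obtain ⟨⟨hn2, hnN⟩, hcop⟩ := hn
    obtain ⟨q, hq, hqn⟩ := Nat.exists_prime_and_dvd (show n ≠ 1 by omega)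
    have hqmem : q ∈ n.primeFactors := Nat.mem_primeFactors.mpr ⟨hq, hqn, by omega⟩
    have h4 := Section15B.pow_four_le_of_mem_primeFactors_of_coprime_frakq hcop hqmem
    have hqn' : q ≤ n := Nat.le_of_dvd (by omega) hqn
    rw [Finset.mem_Ioc]
    refine ⟨?_, by omega⟩
    by_contra hle
    have hqeq : q = D ^ 4 := le_antisymm (hqn'.trans (not_lt.mp hle)) h4
    have hq4 : q ∣ D ^ 4 := by rw [hqeq]
    have hqD : q ∣ D := hq.dvd_of_dvd_pow hq4
    have hqle : q ≤ D := Nat.le_of_dvd (by omega) hqD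
    have hD4 : D < D ^ 4 := by
      calc D = D ^ 1 := (pow_one D).symm
        _ < D ^ 4 := Nat.pow_lt_pow_right (by omega) (by norm_num)
    omega
  have hNT' : (((N - 1 : ℕ) : ℝ)) ≤ Real.exp (2 * Real.log D ^ 9) := hNT.trans hTP2
  have hgB : ∑ n ∈ B, g n ≤ C₃₁ / ell D ^ 2011 := by
    calc ∑ n ∈ B, g n ≤ ∑ n ∈ Finset.Ioc (D ^ 4) (N - 1), g n :=
          Finset.sum_le_sum_of_subset_of_nonneg hsubI fun n _ _ => hg0 n
      _ ≤ C₃₁ / Real.log D ^ 2011 := h31 (N - 1) hNT'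
      _ = C₃₁ / ell D ^ 2011 := by rw [ell]
  exact mul_le_mul (Real.sqrt_le_sqrt hfB) (Real.sqrt_le_sqrt hgB) (Real.sqrt_nonneg _)
    (Real.sqrt_nonneg _)

/-- Eventually `M ≤ 𝓛`. [folklore] -/
private theorem forAllLarge_le_ell' (M : ℝ) : ForAllLarge fun D _ _ => M ≤ ell D := by
  refine ForAllLarge.of_le ⌈Real.exp M⌉₊ fun D _ _ hD _ _ => ?_
  have h : Real.exp M ≤ D := le_trans (Nat.le_ceil _) (by exact_mod_cast hD)
  exact (Real.le_log_iff_exp_le (lt_of_lt_of_le (Real.exp_pos _) h)).mpr h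

/-- `𝓛⁶e^{−c𝓛} ≤ 720/c⁶` for `c > 0`, `𝓛 ≥ 0` (`x⁶/6! ≤ eˣ` at `x = c𝓛`). [folklore] -/
private theorem pow_six_mul_exp_neg_le {c L : ℝ} (hc : 0 < c) (hL : 0 ≤ L) :
    L ^ 6 * Real.exp (-(c * L)) ≤ 720 / c ^ 6 := by
  have h := Real.pow_div_factorial_le_exp (c * L) (by positivity) 6
  rw [show ((Nat.factorial 6 : ℕ) : ℝ) = 720 by norm_num [Nat.factorial]] at h
  rw [Real.exp_neg]
  have hexp : 0 < Real.exp (c * L) := Real.exp_pos _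
  have hc6 : 0 < c ^ 6 := by positivity
  rw [div_le_iff₀ (by norm_num : (0:ℝ) < 720)] at h
  rw [mul_inv_le_iff₀ hexp, div_mul_eq_mul_div, le_div_iff₀ hc6]
  calc L ^ 6 * c ^ 6 = (c * L) ^ 6 := by ring
    _ ≤ 720 * Real.exp (c * L) := by linarith

open scoped Classical in
/-- **The rough part: `S₂ = Σ_{1<n<T,(n,𝒬)=1} τ₂(n)‖ϖ₁ⱼ(n)‖/n ≤ K𝓛⁻⁵`** for all large `D`, under
(A), `1 ≤ j ≤ 3`. With `R = Σ_{(n,𝒬)=1,n<T} τ₂(n)²/n ≤ e²⁷⁶𝓛` (`rough_tauSq_sum_le`),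
`η = |bⱼ|𝓛^{1.1} ≤ 3π(1+5|c′|π)𝓛⁻⁷` ((2.13): `|bⱼ| ≤ 3α(1+5|c′|α𝓛)`, `α = π𝓛⁻⁹`), (15.21)
(`eq15_21_holds`) and Lemma 3.1 (`Lemma31.lemma_3_1`):
`S₂ ≤ ηR + R^{1/2}(C₃₁𝓛⁻²⁰¹¹)^{1/2} + |C₂₁|D⁻ᶜR ≤ K𝓛⁻⁵`. [cite: Zhang2022LandauSiegel, §15 p.87] -/
theorem rough_part_le (c' : ℝ) :
    ∃ K : ℝ, ForAllLarge fun D _ χ => AssumptionA D χ → ∀ j ∈ ({1, 2, 3} : Finset ℕ),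
      ∑ n ∈ (Finset.Ico 2 ⌈bigT D⌉₊).filter (fun n => Nat.Coprime n (frakq D)),
          (n.divisors.card : ℝ) * ‖varpi1 c' χ j n‖ / n ≤ K / ell D ^ 5 := by
  obtain ⟨c, hc, C₂₁, h21⟩ := Section15B.eq15_21_holds c'
  obtain ⟨C₃₁, h31⟩ := Lemma31.lemma_3_1
  set κ : ℝ := 3 * π * (1 + 5 * |c'| * π) with hκ
  set E : ℝ := Real.exp 276 with hE
  set K : ℝ := κ * E + Real.sqrt (E * |C₃₁|) + |C₂₁| * E * (720 / c ^ 6) with hK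
  refine ⟨K, ?_⟩
  set M : ℝ := max 10 (14 * |c'| * π + 1) with hM
  refine (h21.and (forAllLarge_le_ell' M)).mono fun D _ χ hq hp h hA j hj => ?_
  obtain ⟨g21, hMℓ⟩ := h
  have hℓ10 : 10 ≤ ell D := (le_max_left _ _).trans hMℓ
  have hℓc : 14 * |c'| * π + 1 ≤ ell D := (le_max_right _ _).trans hMℓ
  obtain ⟨hD2, hℓ0, h11, hT, hTP, hTP2⟩ := sizes_of_ten_le_ell hℓ10
  obtain ⟨hDN, hN1, hNT⟩ := ceil_facts hT
  obtain ⟨hD3, hαpos, hα1, hαℓ, -⟩ := Section15B.sizes_of_ell_ge c' (by linarith) hℓc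
  have hℓ1 : 1 ≤ ell D := by linarith
  have hD0 : (0 : ℝ) < D := by exact_mod_cast (show 0 < D by omega)
  set L := ell D with hL
  set N := ⌈bigT D⌉₊ with hN
  set B := (Finset.Ico 2 N).filter (fun n => Nat.Coprime n (frakq D)) with hB
  set B' := (Finset.Ico 1 N).filter (fun n => Nat.Coprime n (frakq D)) with hB'
  -- `bⱼ` and `η`
  obtain ⟨b, hb, hbb⟩ := AppendixB.betaJ_bound c' D j hαpos.le hℓ0.le
  have hα : alpha D = π / L ^ 9 := by rw [alpha, bigP, Real.log_exp]
  have hb' : |b| ≤ κ / L ^ 9 := by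
    have hαℓπ : alpha D * L ≤ π := hαℓ.trans (div_le_self Real.pi_pos.le hℓ1)
    have h1 : 1 + 5 * |c'| * alpha D * L ≤ 1 + 5 * |c'| * π := by
      nlinarith [mul_le_mul_of_nonneg_left hαℓπ (show (0:ℝ) ≤ 5 * |c'| by positivity)]
    calc |b| ≤ 3 * alpha D * (1 + 5 * |c'| * alpha D * L) := hbb
      _ ≤ 3 * alpha D * (1 + 5 * |c'| * π) :=
          mul_le_mul_of_nonneg_left h1 (by positivity)
      _ = κ / L ^ 9 := by rw [hα, hκ]; ring
  set η : ℝ := |b| * L ^ (1.1 : ℝ) with hη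
  have hη0 : 0 ≤ η := by rw [hη]; exact mul_nonneg (abs_nonneg b) (Real.rpow_nonneg hℓ0.le _)
  have hηle : η ≤ κ / L ^ 7 := by
    have hκ0 : 0 ≤ κ := by rw [hκ]; positivity
    calc η ≤ κ / L ^ 9 * L ^ 2 := mul_le_mul hb' h11 (Real.rpow_nonneg hℓ0.le _) (by positivity)
      _ = κ / L ^ 7 := by field_simp
  -- `R`
  set R : ℝ := ∑ n ∈ B', (n.divisors.card : ℝ) ^ 2 / n with hR
  have hR0 : 0 ≤ R := Finset.sum_nonneg fun n _ => by positivity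
  have hRle : R ≤ E * L := rough_tauSq_sum_le hℓ10
  -- the pointwise bound summed over `B`
  have hpt : ∀ n ∈ B, (n.divisors.card : ℝ) * ‖varpi1 c' χ j n‖ / n ≤
      η * ((n.divisors.card : ℝ) ^ 2 / n) + (n.divisors.card : ℝ) * ‖nu χ n‖ / n +
        |C₂₁| * (D : ℝ) ^ (-c) * ((n.divisors.card : ℝ) ^ 2 / n) := by
    intro n hn
    rw [hB, Finset.mem_filter, Finset.mem_Ico] at hn
    obtain ⟨⟨hn2, hnN⟩, hcop⟩ := hn
    have hnT : (n : ℝ) < bigT D := Nat.lt_ceil.mp hnN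
    have hnP : (n : ℝ) < bigP D / bigT D ^ 3 := lt_of_lt_of_le hnT hTP
    have e21 := g21 hA j hj n (by omega) hnP hcop
    exact rough_pointwise c' χ j hb (by omega) hnT e21
  have hsumB : ∑ n ∈ B, (n.divisors.card : ℝ) ^ 2 / n ≤ R := by
    refine Finset.sum_le_sum_of_subset_of_nonneg (fun n hn => ?_) fun n _ _ => by positivity
    rw [hB, Finset.mem_filter, Finset.mem_Ico] at hn
    rw [hB', Finset.mem_filter, Finset.mem_Ico]
    exact ⟨⟨by omega, hn.1.2⟩, hn.2⟩
  have h31' : ∀ M' : ℕ, (M' : ℝ) ≤ Real.exp (2 * Real.log D ^ 9) →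
      ∑ n ∈ Finset.Ioc (D ^ 4) M', ‖nu χ n‖ ^ 2 / n ≤ C₃₁ / Real.log D ^ 2011 := by
    intro M' hM'
    have h := h31 D χ hp hq.sq_eq_one (by change 3 ≤ L; linarith) hA.le M' hM'
    simpa [nu] using h
  have hν := nu_part_le χ hℓ10 h31'
  -- the three terms
  have hDc : (D : ℝ) ^ (-c) = Real.exp (-(c * L)) := by
    rw [Real.rpow_def_of_pos hD0, hL, ell]; ring_nf
  have hDc0 : 0 ≤ (D : ℝ) ^ (-c) := Real.rpow_nonneg hD0.le _
  have t1 : η * R ≤ κ * E / L ^ 5 := by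
    calc η * R ≤ κ / L ^ 7 * (E * L) := mul_le_mul hηle hRle hR0 (by rw [hκ]; positivity)
      _ = κ * E / L ^ 5 * (1 / L) := by field_simp
      _ ≤ κ * E / L ^ 5 * 1 := by
          refine mul_le_mul_of_nonneg_left ?_ (by rw [hκ, hE]; positivity)
          rw [div_le_one hℓ0]; exact hℓ1
      _ = κ * E / L ^ 5 := mul_one _
  have t2 : Real.sqrt R * Real.sqrt (C₃₁ / L ^ 2011) ≤ Real.sqrt (E * |C₃₁|) / L ^ 5 := by
    have h1 : Real.sqrt (C₃₁ / L ^ 2011) ≤ Real.sqrt (|C₃₁| / L ^ 2011) :=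
      Real.sqrt_le_sqrt (div_le_div_of_nonneg_right (le_abs_self _) (by positivity))
    have h2 : Real.sqrt R ≤ Real.sqrt (E * L) := Real.sqrt_le_sqrt hRle
    calc Real.sqrt R * Real.sqrt (C₃₁ / L ^ 2011)
        ≤ Real.sqrt (E * L) * Real.sqrt (|C₃₁| / L ^ 2011) :=
          mul_le_mul h2 h1 (Real.sqrt_nonneg _) (Real.sqrt_nonneg _)
      _ = Real.sqrt (E * L * (|C₃₁| / L ^ 2011)) := (Real.sqrt_mul (by rw [hE]; positivity) _).symm
      _ ≤ Real.sqrt (E * |C₃₁| / (L ^ 5) ^ 2) := by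
          refine Real.sqrt_le_sqrt ?_
          rw [show E * L * (|C₃₁| / L ^ 2011) = E * |C₃₁| * (L / L ^ 2011) by ring,
            show E * |C₃₁| / (L ^ 5) ^ 2 = E * |C₃₁| * (1 / L ^ 10) by ring]
          refine mul_le_mul_of_nonneg_left ?_ (by rw [hE]; positivity)
          rw [div_le_div_iff₀ (by positivity) (by positivity), one_mul]
          calc L * L ^ 10 = L ^ 11 := by ring
            _ ≤ L ^ 2011 := pow_le_pow_right₀ hℓ1 (by norm_num)
      _ = Real.sqrt (E * |C₃₁|) / L ^ 5 := by
          rw [Real.sqrt_div (by rw [hE]; positivity), Real.sqrt_sq (by positivity)]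
  have t3 : |C₂₁| * (D : ℝ) ^ (-c) * R ≤ |C₂₁| * E * (720 / c ^ 6) / L ^ 5 := by
    have h6 := pow_six_mul_exp_neg_le hc hℓ0.le
    rw [hDc]
    calc |C₂₁| * Real.exp (-(c * L)) * R ≤ |C₂₁| * Real.exp (-(c * L)) * (E * L) :=
          mul_le_mul_of_nonneg_left hRle (mul_nonneg (abs_nonneg _) (Real.exp_pos _).le)
      _ = |C₂₁| * E * (L ^ 6 * Real.exp (-(c * L))) / L ^ 5 := by field_simp
      _ ≤ |C₂₁| * E * (720 / c ^ 6) / L ^ 5 := by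
          refine div_le_div_of_nonneg_right ?_ (by positivity)
          exact mul_le_mul_of_nonneg_left h6 (by rw [hE]; positivity)
  -- assemble
  calc ∑ n ∈ B, (n.divisors.card : ℝ) * ‖varpi1 c' χ j n‖ / n
      ≤ ∑ n ∈ B, (η * ((n.divisors.card : ℝ) ^ 2 / n) + (n.divisors.card : ℝ) * ‖nu χ n‖ / n +
          |C₂₁| * (D : ℝ) ^ (-c) * ((n.divisors.card : ℝ) ^ 2 / n)) := Finset.sum_le_sum hpt
    _ = η * ∑ n ∈ B, (n.divisors.card : ℝ) ^ 2 / n +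
          ∑ n ∈ B, (n.divisors.card : ℝ) * ‖nu χ n‖ / n +
          |C₂₁| * (D : ℝ) ^ (-c) * ∑ n ∈ B, (n.divisors.card : ℝ) ^ 2 / n := by
        rw [Finset.sum_add_distrib, Finset.sum_add_distrib, Finset.mul_sum, Finset.mul_sum]
    _ ≤ η * R + Real.sqrt R * Real.sqrt (C₃₁ / L ^ 2011) + |C₂₁| * (D : ℝ) ^ (-c) * R := by
        gcongr
    _ ≤ κ * E / L ^ 5 + Real.sqrt (E * |C₃₁|) / L ^ 5 + |C₂₁| * E * (720 / c ^ 6) / L ^ 5 := by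
        linarith
    _ = K / L ^ 5 := by rw [hK]; ring

end Rough

/-! ## §4. The leaf -/

open scoped Classical in
/-- **`Z22:§15.u050` DISCHARGED** (§15 p.87, tex L4314–L4315: "This yields, by (15.21),
`Σ_{n∉𝒩(𝒬), n<T} χ(n)τ₂(n)ϖ₁ⱼ(n)/n ≪ 1/𝓛`"), for the manuscript's own objects (`inputs15AB`) and
every `c′`: the v19 frontier leaf `h15u050`. Proof: `‖Σ‖ ≤ S₁·S₂` (`norm_sumNotInN_le_mul`, using the
multiplicativity of `ϖ₁ⱼ`, `inline15_varpiMult_holds`) with `S₁ ≤ K₁𝓛⁴` (`smooth_part_le`) and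
`S₂ ≤ K₂𝓛⁻⁵` (`rough_part_le`). [cite: Zhang2022LandauSiegel, §15 p.87] -/
theorem step15_u050_holds (c' : ℝ) : Step15_u050 c' inputs15AB := by
  obtain ⟨K₁, h1⟩ := smooth_part_le c'
  obtain ⟨K₂, h2⟩ := rough_part_le c'
  refine ⟨max K₁ 0 * max K₂ 0, ?_⟩
  refine (((h1.and h2).and (Section15B.inline15_varpiMult_holds c')).and
    (forAllLarge_le_ell' 1)).mono fun D _ χ _ _ h hA j hj => ?_
  obtain ⟨⟨⟨g1, g2⟩, gm⟩, hℓ1⟩ := h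
  have hℓ0 : 0 < ell D := by linarith
  have hmul := (gm hA j hj).2
  have hS₁ := g1 hA j hj
  have hS₂ := g2 hA j hj
  have hsplit := norm_sumNotInN_le_mul c' χ j hmul
  set S₁ := ∑ n ∈ (Finset.Ico 1 ⌈bigT D⌉₊).filter (fun n => n ∈ nset (frakq D)),
      (n.divisors.card : ℝ) * ‖varpi1 c' χ j n‖ / n with hS₁def
  set S₂ := ∑ n ∈ (Finset.Ico 2 ⌈bigT D⌉₊).filter (fun n => Nat.Coprime n (frakq D)),
      (n.divisors.card : ℝ) * ‖varpi1 c' χ j n‖ / n with hS₂def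
  have hS₁0 : 0 ≤ S₁ := Finset.sum_nonneg fun n _ => by positivity
  have hS₂0 : 0 ≤ S₂ := Finset.sum_nonneg fun n _ => by positivity
  have hS₁' : S₁ ≤ max K₁ 0 * ell D ^ 4 :=
    hS₁.trans (mul_le_mul_of_nonneg_right (le_max_left _ _) (by positivity))
  have hS₂' : S₂ ≤ max K₂ 0 / ell D ^ 5 :=
    hS₂.trans (div_le_div_of_nonneg_right (le_max_left _ _) (by positivity))
  calc ‖sumNotInN c' inputs15AB χ j‖ ≤ S₁ * S₂ := hsplit
    _ ≤ (max K₁ 0 * ell D ^ 4) * (max K₂ 0 / ell D ^ 5) :=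
        mul_le_mul hS₁' hS₂' hS₂0 (by positivity)
    _ = max K₁ 0 * max K₂ 0 / ell D := by field_simp

end Literature.NumberTheory.LFunctions.Zhang2022.Typed.Section15C
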